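import Literature.AlgebraicGeometry.Frobenioids.EndomorphismsHolds
import Literature.AlgebraicGeometry.Frobenioids.EndomorphismsCounterexample
import HarnessLib

/-!
# Frobenioids I, Proposition 1.12 (ii) necessity / (iii): the typed statements as SCHEMATA — exact
# universal closures refuted, instance forms over bases with torsion automorphism groups proved

Mochizuki, *The geometry of Frobenioids I: the general theory*, Kyushu J. Math. **62** (2008)
293–400, §1, Proposition 1.12 (ii), (iii), kurims text p. 39 [cite: MochizukiFrdI2008, Prop. 1.12].

PROOF-ONLY companion of `Endomorphisms.lean` (abc-iut cell, F fact-proving wave, seat abc-iut-f-040;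
FACT-LIST rows F-1080 `PreFrobenioid.SubAutomorphismIsIsometryStatement` = the printed necessity of
(ii) "a sub-automorphism is isometric", and F-1079 `PreFrobenioid.SubAutomorphismIsIsoIffStatement` =
(iii) "a sub-automorphism of `A` is an automorphism if and only if it is a base-isomorphism"; both are
`Prop`-valued statements `(F) (A : C)` of abc-iut-L1-t1, never asserted; nothing is restated). Sibling
of abc-iut-f-039's `EndomorphismsHolds.lean` (rows F-1076/F-1077/F-1078), whose finite-automorphism
lemma `isAutNonExpandingOn_of_finite_aut` and instance `subAutomorphismIsIsometryStatement_of_finite_aut`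
are reused BY NAME. This file:

* records the EXACT universal closures of the two statements as FALSE (`not_forall_…`), by the
  kernel-checked elementary Frobenioid of `EndomorphismsCounterexample.lean` (abc-iut-L1-t1: `ℚ_{≥0}`
  over `B(ℤ)`, generator acting by `2`) — also in the sharper form "false even among Frobenioids";
* proves the INSTANCE FORMS over every (pre-)Frobenioid whose base category has TORSION automorphism
  groups (every `b ∈ Aut_D(A)` of finite order; finite `Aut_D(A)` is the special case of
  `EndomorphismsHolds.lean`): there the elementwise hypothesis (H) `IsAutNonExpandingOn Φ` of
  `EndomorphismsNonExpanding.lean` is automatic, so the printed Remark-1.1.1 argument applies;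
* the NAMED instances: every Frobenioid over the bases `FinSubextCat F K = B(Gal(K/F))⁰` of [FrdI]
  Ex. 6.1/6.3 (finite automorphism groups, abc-iut-L6-t10's `FinSubextCat.finite_aut`), in particular
  THE arithmetic Frobenioid `C_{K/F}` of Ex. 6.3 / Thm. 6.4 — where the literal equality `AutFixesDiv`
  of the printed proof FAILS (a Galois automorphism moves a prime) — and [FrdII] Ex. 3.3's `C_v` over
  the one-morphism base at `Spec ℂ` (abc-iut-f-039's `autFixesDiv_Cpt`).

HONEST LABEL. The universal closures are false; the instance forms are theorems; which extra
hypothesis the author intends is not asserted. Prop. 1.12 is not cited by [IUTchI–IV] (cell census);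
no side taken on [IUTchIII] Cor. 3.12; typed ≠ proved; proved = OUR kernel check. No definition, no
named fact, no `sorry`.
-/

namespace Literature.AlgebraicGeometry.Frobenioids

open CategoryTheory Opposite

universe w v v' u u'

/-! ### Torsion automorphism groups of the base force the non-expanding hypothesis (H) -/

section Torsion

variable {D : Type u} [Category.{v} D] {Φ : Dᵒᵖ ⥤ CommMonCat.{w}}

/-- If every automorphism of every object of `D` has FINITE ORDER (torsion automorphism groups — e.g.
finite ones), then for `Φ` with divisorial values the hypothesis (H) `IsAutNonExpandingOn Φ` ("base
automorphisms never strictly enlarge a divisor") holds: `b^k = 1` gives `(b^*)^k = id`.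
[cite: MochizukiFrdI2008, Prop. 1.12(ii) p.39] -/
theorem isAutNonExpandingOn_of_aut_isOfFinOrder (hdiv : ∀ A : D, IsDivisorial (Φ.obj (op A)))
    (hfin : ∀ (A : D) (b : Aut A), IsOfFinOrder b) : IsAutNonExpandingOn Φ := by
  refine isAutNonExpandingOn_of_finite_order hdiv fun A b => ?_
  obtain ⟨k, hk, hbk⟩ := (hfin A b).exists_pow_eq_one
  refine ⟨k, hk, fun x => ?_⟩
  rw [← pull_aut_pow_apply Φ b k, hbk]
  exact pull_id Φ A x

end Torsion

namespace PreFrobenioid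

/-! ### The exact universal closures of the typed statements are false -/

/-- **F-1080 as a SCHEMA: the universal closure of `SubAutomorphismIsIsometryStatement` is FALSE.**
Witness: abc-iut-L1-t1's elementary Frobenioid (`EndomorphismsCounterexample`): the sub-automorphism
`α = (b, 1, 1)` of its object `A` has zero divisor `1 ≠ 0`. [cite: MochizukiFrdI2008, Prop. 1.12(ii) p.39] -/
theorem not_forall_subAutomorphismIsIsometryStatement :
    ¬ ∀ (D : Type) [Category.{0} D] (Φ : Dᵒᵖ ⥤ CommMonCat.{0}) (C : Type) [Category.{0} C]
        (F : C ⥤ ElemFrobenioid Φ) (A : C), SubAutomorphismIsIsometryStatement F A :=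
  fun h => EndomorphismsCounterexample.not_subAutomorphismIsIsometryStatement
    (h _ _ _ (ElemFrobenioid.toChar EndomorphismsCounterexample.Φex) EndomorphismsCounterexample.A)

/-- F-1080, sharper: the printed necessity of Prop. 1.12 (ii) fails even among FROBENIOIDS
([FrdI] Def. 1.3; the witness is a Frobenioid by Prop. 1.5). [cite: MochizukiFrdI2008, Prop. 1.12(ii) p.39] -/
theorem not_forall_isFrobenioid_subAutomorphismIsIsometryStatement :
    ¬ ∀ (D : Type) [Category.{0} D] (Φ : Dᵒᵖ ⥤ CommMonCat.{0}) (C : Type) [Category.{0} C]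
        (F : C ⥤ ElemFrobenioid Φ), IsFrobenioid F → ∀ A : C, SubAutomorphismIsIsometryStatement F A :=
  fun h => EndomorphismsCounterexample.not_subAutomorphismIsIsometryStatement
    (h _ _ _ (ElemFrobenioid.toChar EndomorphismsCounterexample.Φex)
      EndomorphismsCounterexample.isFrobenioid EndomorphismsCounterexample.A)

/-- **F-1079 as a SCHEMA: the universal closure of `SubAutomorphismIsIsoIffStatement` is FALSE.**
Witness: the same `α` is a base-isomorphic sub-automorphism that is not an automorphism.
[cite: MochizukiFrdI2008, Prop. 1.12(iii) p.39] -/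
theorem not_forall_subAutomorphismIsIsoIffStatement :
    ¬ ∀ (D : Type) [Category.{0} D] (Φ : Dᵒᵖ ⥤ CommMonCat.{0}) (C : Type) [Category.{0} C]
        (F : C ⥤ ElemFrobenioid Φ) (A : C), SubAutomorphismIsIsoIffStatement F A :=
  fun h => EndomorphismsCounterexample.not_subAutomorphismIsIsoIffStatement
    (h _ _ _ (ElemFrobenioid.toChar EndomorphismsCounterexample.Φex) EndomorphismsCounterexample.A)

/-- F-1079, sharper: Prop. 1.12 (iii) as printed fails even among FROBENIOIDS ([FrdI] Def. 1.3).
[cite: MochizukiFrdI2008, Prop. 1.12(iii) p.39] -/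
theorem not_forall_isFrobenioid_subAutomorphismIsIsoIffStatement :
    ¬ ∀ (D : Type) [Category.{0} D] (Φ : Dᵒᵖ ⥤ CommMonCat.{0}) (C : Type) [Category.{0} C]
        (F : C ⥤ ElemFrobenioid Φ), IsFrobenioid F → ∀ A : C, SubAutomorphismIsIsoIffStatement F A :=
  fun h => EndomorphismsCounterexample.not_subAutomorphismIsIsoIffStatement
    (h _ _ _ (ElemFrobenioid.toChar EndomorphismsCounterexample.Φex)
      EndomorphismsCounterexample.isFrobenioid EndomorphismsCounterexample.A)

/-! ### Instance forms: bases with torsion / finite automorphism groups -/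

section Instances

variable {D : Type u} [Category.{v} D] {Φ : Dᵒᵖ ⥤ CommMonCat.{w}} {C : Type u'} [Category.{v'} C]
  {F : C ⥤ ElemFrobenioid Φ}

/-- **Prop. 1.12 (ii), printed necessity (F-1080), over a base with torsion automorphism groups**: in
a pre-Frobenioid `C → F_Φ` over a base all of whose automorphisms have finite order, every
sub-automorphism is isometric. [cite: MochizukiFrdI2008, Prop. 1.12(ii) p.39] -/
theorem subAutomorphismIsIsometryStatement_of_aut_isOfFinOrder (hP : IsPreFrobenioid Φ F)
    (hfin : ∀ (A : D) (b : Aut A), IsOfFinOrder b) (A : C) : SubAutomorphismIsIsometryStatement F A :=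
  subAutomorphismIsIsometryStatement_of_isAutNonExpandingOn hP
    (isAutNonExpandingOn_of_aut_isOfFinOrder (fun X => hP.isDivisorial X) hfin) A

/-- **Prop. 1.12 (iii) (F-1079) over a base with torsion automorphism groups**: in a Frobenioid over
such a base, a sub-automorphism is an automorphism iff it is a base-isomorphism.
[cite: MochizukiFrdI2008, Prop. 1.12(iii) p.39] -/
theorem subAutomorphismIsIsoIffStatement_of_aut_isOfFinOrder (hF : IsFrobenioid F)
    (hfin : ∀ (A : D) (b : Aut A), IsOfFinOrder b) (A : C) : SubAutomorphismIsIsoIffStatement F A :=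
  subAutomorphismIsIsoIffStatement_of_isAutNonExpandingOn hF
    (isAutNonExpandingOn_of_aut_isOfFinOrder (fun X => hF.isPreFrobenioid.isDivisorial X) hfin) A

/-- **Prop. 1.12 (iii) (F-1079) over a base with FINITE automorphism groups** (the (ii)-companion is
abc-iut-f-039's `subAutomorphismIsIsometryStatement_of_finite_aut`).
[cite: MochizukiFrdI2008, Prop. 1.12(iii) p.39] -/
theorem subAutomorphismIsIsoIffStatement_of_finite_aut (hF : IsFrobenioid F)
    (hfin : ∀ A : D, Finite (Aut A)) (A : C) : SubAutomorphismIsIsoIffStatement F A :=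
  subAutomorphismIsIsoIffStatement_of_isAutNonExpandingOn hF
    (isAutNonExpandingOn_of_isPreFrobenioid_of_finite_aut hF.isPreFrobenioid hfin) A

end Instances

/-! ### Named instances: Frobenioids over `FinSubextCat F K`; THE arithmetic Frobenioid `C_{K/F}`;
[FrdII] Ex. 3.3's `C_v` over the one-morphism base -/

section FinSubext

variable {F₀ : Type u} [Field F₀] {K : Type u} [Field K] [Algebra F₀ K]
  {Φ : (FinSubextCat F₀ K)ᵒᵖ ⥤ CommMonCat.{w}} {C : Type u'} [Category.{v'} C]
  {F : C ⥤ ElemFrobenioid Φ}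

/-- **Prop. 1.12 (ii), printed necessity (F-1080), for every pre-Frobenioid over `FinSubextCat F K`**
(the bases `B(Gal(K/F))⁰` of [FrdI] Ex. 6.1/6.3; `Aut_D(Spec L)` is finite).
[cite: MochizukiFrdI2008, Prop. 1.12(ii) p.39] -/
theorem subAutomorphismIsIsometryStatement_finSubextCat (hP : IsPreFrobenioid Φ F) (A : C) :
    SubAutomorphismIsIsometryStatement F A :=
  subAutomorphismIsIsometryStatement_of_finite_aut hP (fun X => FinSubextCat.finite_aut X) A

/-- **Prop. 1.12 (iii) (F-1079) for every Frobenioid over `FinSubextCat F K`**.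
[cite: MochizukiFrdI2008, Prop. 1.12(iii) p.39] -/
theorem subAutomorphismIsIsoIffStatement_finSubextCat (hF : IsFrobenioid F) (A : C) :
    SubAutomorphismIsIsoIffStatement F A :=
  subAutomorphismIsIsoIffStatement_of_finite_aut hF (fun X => FinSubextCat.finite_aut X) A

end FinSubext

end PreFrobenioid

noncomputable section

namespace PreFrobenioid

section Arith

variable (F₀ : Type) [Field F₀] [NumberField F₀] (K : Type) [Field K] [Algebra F₀ K] [IsGalois F₀ K]

/-- **Prop. 1.12 (ii), printed necessity (F-1080), HOLDS for THE arithmetic Frobenioid `C_{K/F}`** of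
[FrdI] Ex. 6.3 / Thm. 6.4 (abc-iut-L6-t10's `arithFrobenioid F K`, a Frobenioid by
`arithFrobenioid_isFrobenioid`), for every object — although `AutFixesDiv` fails there.
[cite: MochizukiFrdI2008, Prop. 1.12(ii) p.39] -/
theorem subAutomorphismIsIsometryStatement_arith (A : arithFrobenioid F₀ K) :
    SubAutomorphismIsIsometryStatement
      (ModelFrobenioid.toElem (arithDivisorFunctor F₀ K) (unitsFunctor F₀ K) (divNatTrans F₀ K)) A :=
  subAutomorphismIsIsometryStatement_finSubextCat (arithFrobenioid_isFrobenioid F₀ K).isPreFrobenioid A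

/-- **Prop. 1.12 (iii) (F-1079) HOLDS for THE arithmetic Frobenioid `C_{K/F}`**: a sub-automorphism of
an object of `C_{K/F}` is an automorphism iff it is a base-isomorphism.
[cite: MochizukiFrdI2008, Prop. 1.12(iii) p.39] -/
theorem subAutomorphismIsIsoIffStatement_arith (A : arithFrobenioid F₀ K) :
    SubAutomorphismIsIsoIffStatement
      (ModelFrobenioid.toElem (arithDivisorFunctor F₀ K) (unitsFunctor F₀ K) (divNatTrans F₀ K)) A :=
  subAutomorphismIsIsoIffStatement_finSubextCat (arithFrobenioid_isFrobenioid F₀ K) A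

end Arith

section Cpt

/-- **Prop. 1.12 (ii), printed necessity (F-1080), for [FrdII] Ex. 3.3's `C_v` over the one-morphism
base at `Spec ℂ`** (abc-iut-L1-t6's `ArchFrd.Cpt`; there even `AutFixesDiv` holds, abc-iut-f-039's
`autFixesDiv_Cpt`), with NO hypothesis. [cite: MochizukiFrdI2008, Prop. 1.12(ii) p.39] -/
theorem subAutomorphismIsIsometryStatement_Cpt (A : ArchFrd.Cpt) :
    SubAutomorphismIsIsometryStatement (ArchFrd.C.toElem ArchFrd.ptBase) A :=
  subAutomorphismIsIsometryStatement_of_autFixesDiv ArchFrd.Cpt.isFrobenioid.isPreFrobenioid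
    autFixesDiv_Cpt A

/-- **Prop. 1.12 (iii) (F-1079) for [FrdII] Ex. 3.3's `C_v` over the one-morphism base at `Spec ℂ`**,
with NO hypothesis. [cite: MochizukiFrdI2008, Prop. 1.12(iii) p.39] -/
theorem subAutomorphismIsIsoIffStatement_Cpt (A : ArchFrd.Cpt) :
    SubAutomorphismIsIsoIffStatement (ArchFrd.C.toElem ArchFrd.ptBase) A :=
  subAutomorphismIsIsoIffStatement_of_autFixesDiv ArchFrd.Cpt.isFrobenioid autFixesDiv_Cpt A

end Cpt

end PreFrobenioid

end

end Literature.AlgebraicGeometry.Frobenioids
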